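import Mathlib
import Summits.Parity.GeneralizedHardyLittlewood.Theorems.PrimeGapTorusCapPart7
import HarnessLib

/-!
# Prime-gap limit points, the torus cap (cell parity-ideate, p4 ROUND-12) — part 8/8 (`half_le_of_torusCap` … `torusCapBrauer_iff`)

Source: `HOME/parity-ideate-p4/round12/Sketch16.lean` (sha16 e5770481db81479a, 7 278 lines, farm rc 0 / 0 sorry /
axioms std-3; namespace `ParityIdeateP4R8`), cut by parity-ideate-lit g32 (`ports/toruscap/build_toruscap.py`) to the
dependency cone (143 declarations) of the eight headline declarations `torusCap_iff`, `torusCapBrauer_iff`,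
`torusCap_half`, `cb1_holds`, `conjHalfStrict_holds`, `NearAP.delannoyNonVanishing_holds`, `capGivesCoverage`,
`residueCoverage_half_of_literature`, in a chain of 8 files of ≤ 400 lines (Theorems-side lint); statements byte-identical
to the source except: `NearAP.P0/P1/P2` are `abbrev` (source: `def` + three `Decidable` instances, dropped per the typing
lint), examples and `decide` rungs outside the cone dropped, namespace `ParityIdeateP4R8` ↦ `Summit.Parity.GeneralizedHardyLittlewood.Theorems.PrimeGapTorusCap`.
Non-Mathlib inputs: `Literature.Combinatorics.Additive.ErdosHeilbronn` (combinatorial Nullstellensatz),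
`Literature.NumberTheory.Sieve.PrimeGapLimitPoints` (`primeGapLimitSet`, `HasPointProperty`, the NAMED fact
`Merikoski2020_theorem1`, used hypothesis-style, never asserted).  No `sorry`, no new axioms, no `instance`, no notation.
Cell-original mathematics (FRONTIER formalisation; nothing here bears on the parity problem beyond the typed statements):
CONJECTURE C of the cell = every measurable `perℤ`-periodic four-point-free `U ⊆ ℝ` has `μ(U ∩ [0,per)) ≤ per/2`,
sharp (mid arc); pay-off: residues of the prime-gap limit-point set `𝓛` modulo `λ` cover ≥ half of `[0, λ)` for every
`λ > 0`, given Merikoski's four-point theorem. HEADLINE DECLS IN THIS PART: `capGivesCoverage`, `torusCap_iff`, `torusCapBrauer_iff`.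
-/

namespace Summit.Parity.GeneralizedHardyLittlewood.Theorems.PrimeGapTorusCap
open MeasureTheory Set Filter Topology Metric
open scoped Pointwise ENNReal
section MidArc

/-- **σ₄ ≥ 1/2 in the kernel**: every admissible torus cap is at least `1/2`. -/
theorem half_le_of_torusCap {σ : ℝ} (h : TorusCap σ) : 1 / 2 ≤ σ := by
  have h1 := h 1 one_pos (midArcSet 1) (measurableSet_midArcSet 1)
    (fun t ht n => midArcSet_periodic ht n) (fourPointFree_midArcSet one_pos)
  rw [volume_midArcSet_inter_Ico one_pos] at h1
  by_contra hlt
  have hlt : σ < 1 / 2 := lt_of_not_ge hlt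
  have : ENNReal.ofReal (σ * 1) < ENNReal.ofReal (1 / 2) := by
    rw [mul_one, ENNReal.ofReal_lt_ofReal_iff (by norm_num)]
    exact hlt
  exact absurd h1 (not_le.2 this)

/-- **p4's typed `CapGivesCoverage`, for EVERY `σ`** (negative `σ` are vacuous by `half_le_of_torusCap`). -/
theorem capGivesCoverage : CapGivesCoverage := by
  intro σ hcap hM
  exact capGivesCoverage_of_nonneg σ (by linarith [half_le_of_torusCap hcap]) hcap hM

end MidArc
/-- **σ₄ = 1/2 EXACTLY:** `TorusCap σ ↔ 1/2 ≤ σ`. -/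
theorem torusCap_iff (σ : ℝ) : TorusCap σ ↔ 1 / 2 ≤ σ := by
  refine ⟨half_le_of_torusCap, fun hσ per hper U hU hperU hfree => ?_⟩
  exact (torusCap_half per hper U hU hperU hfree).trans (ENNReal.ofReal_le_ofReal (by nlinarith))

/-- **σ_B = 1/2 EXACTLY:** `TorusCapBrauer σ ↔ 1/2 ≤ σ` (lower bound through `torusCap_of_torusCapBrauer`). -/
theorem torusCapBrauer_iff (σ : ℝ) : TorusCapBrauer σ ↔ 1 / 2 ≤ σ := by
  refine ⟨fun h => half_le_of_torusCap (torusCap_of_torusCapBrauer h), fun hσ per hper U hU hperU hB => ?_⟩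
  exact (torusCapBrauer_half per hper U hU hperU hB).trans (ENNReal.ofReal_le_ofReal (by nlinarith))

end Summit.Parity.GeneralizedHardyLittlewood.Theorems.PrimeGapTorusCap

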